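import Summits.KontsevichZagierPeriods.KontsevichZagierPeriods.Theses.HurwitzMicroSectors
import Summits.KontsevichZagierPeriods.KontsevichZagierPeriods.Theorems.SectorTwoSix.Negative.LoadBearing
import Literature.NumberTheory.Transcendental.BoxIntegralHurwitzWeightTwo
import Literature.NumberTheory.Transcendental.CalegariDimitrovTangL2Chi3

/-!
# `SectorTwoSix` (stmt-KontsevichZagierPeriods-3870), line `jacobian-monomial-absorption`:
# stub `stub_nfValue` — the value of the normal form `a(1−t⁶) + bt³ + ct⁵`

For the canonical sector representation `sectorRep P = [box, P(t)/(1−t⁶)]` (`t = x₀x₁`, the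
landed `Theorems/SectorTwoSix/Negative/LoadBearing.lean`), the normal form
`P = a(1−t⁶) + bt³ + ct⁵` has value
`∫_{(0,1)²} (a(1−t⁶) + bt³ + ct⁵)/(1−t⁶) = a·1 + b·H₃ + c·H₅` with the tree's level-`6` Hurwitz
values `H₃ = −L(2,χ₋₃)/8 + π²/54`, `H₅ = π²/216`
(`BoxIntegral.setIntegral_box_level_six_three/_five`). The only new ingredient over `LoadBearing`
(`value_sectorRep_add`, `value_sectorRep_one_sub_X_pow_six`, `value_sectorRep_X_pow`) is the
`ℚ`-homogeneity of the value in the numerator, `value_sectorRep_C_mul`.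
-/

noncomputable section

open Set MeasureTheory Polynomial
open Literature.NumberTheory.Transcendental
open Summit.KontsevichZagierPeriods.Theorems.SectorTwoSix.Negative

namespace Summit.KontsevichZagierPeriods.Theorems.HurwitzMicroSectorsSectorTwoSix

/-- Values are `ℚ`-homogeneous in the numerator: `[box, a·Q(t)/(1−t⁶)]` has value
`a · value [box, Q(t)/(1−t⁶)]`. [folklore] -/
theorem value_sectorRep_C_mul (a : ℚ) (Q : ℚ[X]) :
    (sectorRep (C a * Q)).value = (a : ℝ) * (sectorRep Q).value := by
  simp only [KZ.IntegralRep.value, sectorRep_domain, sectorRep_integrand]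
  rw [← integral_const_mul]
  refine setIntegral_congr_fun (BoxIntegral.measurableSet_box 2) fun x _ => ?_
  simp only [sectorFun, map_mul, aeval_C, eq_ratCast, mul_div_assoc]

/-- **Value of the normal form**: `∫_box (a(1−t⁶) + bt³ + ct⁵)/(1−t⁶) = a + bH₃ + cH₅` with
the tree's `H₃ = −L(2,χ₋₃)/8 + π²/54`, `H₅ = π²/216`
(`BoxIntegral.setIntegral_box_level_six_three/five`). [folklore] -/
theorem stub_nfValue : ∀ a b c : ℚ,
    (sectorRep (C a * (1 - X ^ 6) + C b * X ^ 3 + C c * X ^ 5)).value =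
      (a : ℝ) + b * (-(L2chi3 / 8) + Real.pi ^ 2 / 54) + c * (Real.pi ^ 2 / 216) := by
  intro a b c
  rw [value_sectorRep_add, value_sectorRep_add, value_sectorRep_C_mul, value_sectorRep_C_mul,
    value_sectorRep_C_mul, value_sectorRep_one_sub_X_pow_six, mul_one, value_sectorRep_X_pow,
    value_sectorRep_X_pow, BoxIntegral.setIntegral_box_level_six_three,
    BoxIntegral.setIntegral_box_level_six_five]

end Summit.KontsevichZagierPeriods.Theorems.HurwitzMicroSectorsSectorTwoSix

end
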